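import Summits.QuantumFields.YangMills.Theorems.BalabanUVNodesK1EndExactTopRunsFree
import Summits.QuantumFields.YangMills.Theorems.BalabanUVNodesK1EndOfRunRowsNoShrinkSurvCont

/-!
# THE DIAL's POINTWISE LETTER BELOW `b⋆`: NO JUMP OVER THE FOOT — it feeds (T) and no-shrink, not row (iv)
# (port with attribution of ym-nodeO P3 n°101 `TopRunsInRowsCurrency-P3g56.lean` §4–§5, def-free)

Cell `pub-ymgap`, seat `pub-ymgap-dag-n13-w4` (g8), N13 [B16] width seat 4∕4; `--kind proof --supports stmt-QuantumFields-27364 --as helper` (K1⁹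
`…Theses.BalabanUVNodes.StabilityBRunRowsAtRecordR13SepCoPHV`, crux r3 DECIDING, route rev 29, skeleton v10).  FILE 8 of this lineage's END-EXACTNESS census.  PORT WITH ATTRIBUTION of
the YM-NODE-O IDEATION cell's seat P3 («weaken the target») evidence n°101 `run/shared/lean/pub/ym-nodeO-ideate/memos/lines/TopRunsInRowsCurrency-P3g56.lean` (sha256 5a37335addab6d51…,
556 l., g56; evidence row 52 on stmt-QuantumFields-27364) §4 (the converse edge «linear top-run thresholds ⟹ no-shrink», re-typed from P3 n°91; the tree had only ⟹, file 10's
`topRuns_of_noShrink`) and §5 (memo v3.82 census C365 (b)'s located letter, typed by P3): the shapes are written INLINE (theorems only, 0 `def`); P3's names kept decl by decl.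

THE LETTER (supplier-facing).  The END-exact dial of K1⁹ (FILE 1 of g8, p633163) asks, besides (W) and (C), the threshold letter (T): «at every level `γ ≤ γ′` some `g⋆(γ) > 0` below which
no in-`]0,γ]` run that visits `γ` can end».  What POINTWISE property of a history-dependent `β` pays (T)?  The AF sign `0 ≤ β` on the box does (runs are then non-decreasing; FILE 4
p634872), but it is more than needed.  THE WEAKEST POINTWISE LETTER LOCATED SO FAR is P3's **NO-JUMP AT THE FOOT `z` ON LEVEL `γ`**:
  `∀ k v, v ∈ Box γ k → z ≤ v (Fin.last k) → 1∕(v (Fin.last k))² − β k v ≤ 1∕z²`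
(from every box history whose CURRENT coupling is `≥ z`, one (0.20)-step `g_{k+1}⁻² = g_k⁻² − β_k` lands `≥ z`).  It gives (T) with threshold THE FOOT (`topRunsAt_of_noJumpAt`), forces the
sign only AT the foot (`noJumpAt_foot_sign`), contains the sign class (`noJumpAt_of_betaLowerH_zero`), and — as a LADDER with linear feet `z ∈ [cγ, γ]` at every level `γ ≤ γ′` — feeds BOTH
the dial's (T) family and [III] (2.6)'s no-(1+β₀)⁻¹-shrink letter with `β₀ = 1∕c − 1` (★ `dial_of_ladderNoJump`), but NOT row (iv) (FILES 5–6: the sawtooth satisfies the ladder with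
`c = ½` — its teeth are feet — and violates row (iv) at every level).

WHAT THIS FILE PROVES (theorems only; 0 `def`): §1 `noShrink_of_linearTopRuns` (running maximum; with file 10's `topRuns_of_noShrink` the iff `noShrink_iff_linearTopRuns`), `topRunPSFloor_of_linearTopRuns`
(floor currency: the relative floor `((1+β₀)²−1)∕γ²`); §2 the foot letter: `stays_above_of_noJumpAt`, `topRunsAt_of_noJumpAt`, `topRunPSFloor_of_noJumpAt`, `noJumpAt_foot_sign`,
`noJumpAt_of_betaLowerH_zero`, `topRunsAt_self_of_betaLowerH_zero`, `topRun_flat_of_betaLowerH_zero`; §3 the ladder: `topRunsAt_linear_of_noJumpLadder`, `topRunsFamily_of_noJumpLadder`,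
`noShrink_of_noJumpLadder`, ★ `dial_of_ladderNoJump`, `noJumpLadder_one_of_betaLowerH_zero`, `ladderNoJump_of_betaLowerH_zero`.

HONEST FRAMING.  [folklore] real analysis over the tree's carriers (`FlowStep.RGEqH` ∕ `Box`, `Step.InInterval`); implications between HYPOTHESIS SHAPES on an abstract `HBeta`; nothing of
Bałaban asserted; NOTHING about `Node00.betaOfRecord₁₃` inhabited (whether `β_θ` has feet near 0 is NODE O's question); no item filed ∕ re-keyed (R-30: the dial stays a located reserve; HARD
FREEZE №216); K1⁹ NOT closed (0∕6 stubs); N13 NOT discharged; counts UNMOVED (typed 28∕28 · discharged 5∕27 · A 5∕28).  One finite 𝕋⁴ programme at fixed ε; R4 = the CONDITIONAL finite-𝕋⁴ rung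
`BalabanLadder.UV` only — the Yang–Mills mass gap (Clay) is NOT proved by any of this; nothing continuum ∕ ℝ⁴ ∕ OS.  No `sorry`, no `axiom`, no `def`, no `instance`, no `notation`.
Sources (locators only): [Balaban1987RG1] Commun. Math. Phys. 109 (1987) (0.20) p. 256, Thm 2 p. 259 (first sentence); [Balaban1988Convergent] Commun. Math. Phys. 119 (1988) (2.6) p. 255
(last member); [Balaban1989LargeFieldII] Thm 1 + (0.1) pp. 355–356 (where K1's rows are consumed).
-/

noncomputable section

open scoped BigOperators

namespace Summit.QuantumFields.YangMills.Theorems.BalabanUVNodesK1EndExactNoJumpLadder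

open Literature.MathematicalPhysics.QuantumFieldTheory.Balaban1983to89
open Literature.MathematicalPhysics.QuantumFieldTheory.Balaban1983to89.FlowStep (HBeta prefixOf prefixOf_apply Box mem_box RGEqH BetaLowerH)
open Summit.QuantumFields.YangMills.Theorems.BalabanUVNodesK1EndOfRunRowsNoShrinkSurvCont (topRuns_of_noShrink)
open Summit.QuantumFields.YangMills.Theorems.BalabanUVNodesK1EndExactTopRunsFree (exists_runMax topRunPSFloor_of_topRunsAt)

variable {β : HBeta}

/-! ## §1 Linear thresholds ⟺ no-shrink (the converse edge) — P3 n°101 §4 -/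

section LinearThresholds

/-- **LINEAR TOP-RUN THRESHOLDS AT EVERY LEVEL `≤ γ_R` FORBID (1+β₀)⁻¹-SHRINK between ANY two times of an in-`]0,γ_R]` run** — the converse of file 10's `topRuns_of_noShrink` (p617600):
read the run's initial segment `[0, n′]` at the level of its own maximum `g_{k₀}`; there it touches the top at `k₀`, so `g_{n′} ≥ g_{k₀}∕(1+β₀) ≥ g_m∕(1+β₀)`.  P3 n°101 `runwiseMulFloor_of_linearTopRuns`
(n°91 :138's running-maximum proof). [cite: Balaban1988Convergent, (2.6) p.255 (last member); Balaban1987RG1, (0.20) p.256, Thm 2 p.259 (first sentence) (elementary)] -/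
theorem noShrink_of_linearTopRuns {β₀ γR : ℝ} (hβ₀ : 0 ≤ β₀)
    (h : ∀ γ : ℝ, 0 < γ → γ ≤ γR →
      ∀ (n : ℕ) (gs : ℕ → ℝ), RGEqH n β gs → Step.InInterval γ n gs → ∀ k, k ≤ n → gs k = γ → γ / (1 + β₀) ≤ gs n) :
    ∀ (n : ℕ) (gs : ℕ → ℝ), RGEqH n β gs → Step.InInterval γR n gs → ∀ m n', m < n' → n' ≤ n → gs m ≤ (1 + β₀) * gs n' := by
  intro n gs hrg hI m n' hm hn'
  obtain ⟨k₀, hk₀, hmax⟩ := exists_runMax gs n'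
  have hγt : 0 < gs k₀ := (hI k₀ (hk₀.trans hn')).1
  have hIt : Step.InInterval (gs k₀) n' gs := fun i hi => ⟨(hI i (hi.trans hn')).1, hmax i hi⟩
  have hend : gs k₀ / (1 + β₀) ≤ gs n' :=
    h (gs k₀) hγt (hI k₀ (hk₀.trans hn')).2 n' gs (fun k hk => hrg k (lt_of_lt_of_le hk hn')) hIt k₀ hk₀ rfl
  have h1 : (0 : ℝ) < 1 + β₀ := by linarith
  calc gs m ≤ gs k₀ := hmax m hm.le
    _ = (1 + β₀) * (gs k₀ / (1 + β₀)) := by field_simp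
    _ ≤ (1 + β₀) * gs n' := mul_le_mul_of_nonneg_left hend h1.le

/-- **NO-(1+β₀)⁻¹-SHRINK AT LEVEL `γ_R` ⟺ LINEAR TOP-RUN THRESHOLDS `γ∕(1+β₀)` AT EVERY LEVEL `≤ γ_R`** (`0 ≤ β₀`): file 10's `topRuns_of_noShrink` BY NAME and §1's converse.
P3 n°101 `runwiseMulFloor_iff_linearTopRuns`. [cite: Balaban1988Convergent, (2.6) p.255 (last member); Balaban1987RG1, Thm 2 p.259 (first sentence) (elementary)] -/
theorem noShrink_iff_linearTopRuns {β₀ γR : ℝ} (hβ₀ : 0 ≤ β₀) :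
    (∀ (n : ℕ) (gs : ℕ → ℝ), RGEqH n β gs → Step.InInterval γR n gs → ∀ m n', m < n' → n' ≤ n → gs m ≤ (1 + β₀) * gs n') ↔
      ∀ γ : ℝ, 0 < γ → γ ≤ γR →
        ∀ (n : ℕ) (gs : ℕ → ℝ), RGEqH n β gs → Step.InInterval γ n gs → ∀ k, k ≤ n → gs k = γ → γ / (1 + β₀) ≤ gs n :=
  ⟨topRuns_of_noShrink hβ₀, noShrink_of_linearTopRuns hβ₀⟩

/-- **IN FLOOR CURRENCY THE LINEAR THRESHOLD IS THE RELATIVE FLOOR `((1+β₀)² − 1)∕γ²`** on the top-anchored tails of level `γ` — unbounded as `γ → 0⁺` unless `β₀ = 0`, which is why the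
no-shrink letter gives (T) at every level (FILE 7's `∀γ ∃M`) but no level-uniform `M` (row (iv)) by itself. P3 n°101 `topRunPSFloor_of_linearTopRuns`.
[cite: Balaban1987RG1, (0.20) p.256; Balaban1988Convergent, (2.6) p.255 (elementary)] -/
theorem topRunPSFloor_of_linearTopRuns {β₀ γR : ℝ} (hβ₀ : 0 ≤ β₀)
    (h : ∀ γ : ℝ, 0 < γ → γ ≤ γR →
      ∀ (n : ℕ) (gs : ℕ → ℝ), RGEqH n β gs → Step.InInterval γ n gs → ∀ k, k ≤ n → gs k = γ → γ / (1 + β₀) ≤ gs n)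
    {γ : ℝ} (hγ : 0 < γ) (hle : γ ≤ γR) :
    ∀ (n : ℕ) (gs : ℕ → ℝ), RGEqH n β gs → Step.InInterval γ n gs →
      ∀ k, k ≤ n → gs k = γ → -(((1 + β₀) ^ 2 - 1) / γ ^ 2) ≤ ∑ j ∈ Finset.Ico k n, β j (prefixOf gs j) := by
  have h1 : (0 : ℝ) < 1 + β₀ := by linarith
  have hT := topRunPSFloor_of_topRunsAt (β := β) (div_pos hγ h1) (h γ hγ hle)
  have heq : 1 / (γ / (1 + β₀)) ^ 2 - 1 / γ ^ 2 = ((1 + β₀) ^ 2 - 1) / γ ^ 2 := by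
    field_simp
  rw [← heq]
  exact hT

end LinearThresholds

/-! ## §2 No jump over the foot `z` at level `γ`: (T) with threshold the foot; the sign only at the foot; the sign class inside — P3 n°101 §5 -/

section Foot

/-- **ONCE AT OR ABOVE THE FOOT, FOREVER AT OR ABOVE IT** (the no-jump letter at `z` on level `γ`, inline as `h`): along an in-`]0,γ]` solution of (0.20), `z ≤ g_k` gives `z ≤ g_m` for all
`k ≤ m ≤ n` (FILES 5–6's `stays_above_tooth` with the tooth replaced by the letter's foot). P3 n°101 `stays_above_of_noJumpAt`. [cite: Balaban1987RG1, (0.20) p.256 (the recursion; elementary)] -/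
theorem stays_above_of_noJumpAt {z γ : ℝ} (hz : 0 < z)
    (h : ∀ (k : ℕ) (v : Fin (k + 1) → ℝ), v ∈ Box γ k → z ≤ v (Fin.last k) → 1 / (v (Fin.last k)) ^ 2 - β k v ≤ 1 / z ^ 2)
    {n : ℕ} {gs : ℕ → ℝ} (hrg : RGEqH n β gs) (hI : Step.InInterval γ n gs) {k : ℕ} (hzk : z ≤ gs k) : ∀ m, k ≤ m → m ≤ n → z ≤ gs m := by
  intro m hkm hmn
  induction m, hkm using Nat.le_induction with
  | base => exact hzk
  | succ m hkm ih =>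
    have hm : m < n := Nat.lt_of_succ_le hmn
    have hzm : z ≤ gs m := ih hm.le
    have hpos1 : 0 < gs (m + 1) := (hI (m + 1) hmn).1
    have hstep : 1 / (gs (m + 1)) ^ 2 = 1 / (gs m) ^ 2 - β m (prefixOf gs m) := by
      have := hrg m hm
      linarith
    have hbox : prefixOf gs m ∈ Box γ m := mem_box.mpr fun i => by
      rw [prefixOf_apply]; exact hI i (le_trans (Nat.lt_succ_iff.mp i.isLt) hm.le)
    have hle : 1 / (gs (m + 1)) ^ 2 ≤ 1 / z ^ 2 := by
      rw [hstep]
      have := h m (prefixOf gs m) hbox (by rw [prefixOf_apply, Fin.val_last]; exact hzm)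
      rwa [prefixOf_apply, Fin.val_last] at this
    have hsq : z ^ 2 ≤ (gs (m + 1)) ^ 2 := (one_div_le_one_div (by positivity) (by positivity)).mp hle
    exact (pow_le_pow_iff_left₀ hz.le hpos1.le two_ne_zero).mp hsq

/-- **THE LETTER GIVES (T) WITH THRESHOLD = THE FOOT** (`0 < z ≤ γ`): an in-`]0,γ]` run touching the top sits above `z` from then on. P3 n°101 `topRunsAt_of_noJumpAt`.
[cite: Balaban1987RG1, Thm 2 p.259 (first sentence), (0.20) p.256 (the letter; elementary)] -/
theorem topRunsAt_of_noJumpAt {z γ : ℝ} (hz : 0 < z) (hzγ : z ≤ γ)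
    (h : ∀ (k : ℕ) (v : Fin (k + 1) → ℝ), v ∈ Box γ k → z ≤ v (Fin.last k) → 1 / (v (Fin.last k)) ^ 2 - β k v ≤ 1 / z ^ 2) :
    ∀ (n : ℕ) (gs : ℕ → ℝ), RGEqH n β gs → Step.InInterval γ n gs → ∀ k, k ≤ n → gs k = γ → z ≤ gs n :=
  fun n gs hrg hI k hk hgk => stays_above_of_noJumpAt hz h hrg hI (by rw [hgk]; exact hzγ) n hk le_rfl

/-- … equivalently, in FILE 7's floor currency, the top-anchored floor `z⁻² − γ⁻²` at level `γ`. P3 n°101 `topRunPSFloor_of_noJumpAt`. [cite: Balaban1987RG1, (0.20) p.256 (elementary)] -/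
theorem topRunPSFloor_of_noJumpAt {z γ : ℝ} (hz : 0 < z) (hzγ : z ≤ γ)
    (h : ∀ (k : ℕ) (v : Fin (k + 1) → ℝ), v ∈ Box γ k → z ≤ v (Fin.last k) → 1 / (v (Fin.last k)) ^ 2 - β k v ≤ 1 / z ^ 2) :
    ∀ (n : ℕ) (gs : ℕ → ℝ), RGEqH n β gs → Step.InInterval γ n gs →
      ∀ k, k ≤ n → gs k = γ → -(1 / z ^ 2 - 1 / γ ^ 2) ≤ ∑ j ∈ Finset.Ico k n, β j (prefixOf gs j) :=
  topRunPSFloor_of_topRunsAt hz (topRunsAt_of_noJumpAt hz hzγ h)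

/-- **THE LETTER FORCES THE SIGN AT THE FOOT ONLY**: `0 ≤ β_{k+1}` at every box history whose current coupling IS `z` (elsewhere `β` may be negative — the sawtooth of FILES 5–6 is, between
its teeth). P3 n°101 `noJumpAt_foot_sign`. [folklore] -/
theorem noJumpAt_foot_sign {z γ : ℝ}
    (h : ∀ (k : ℕ) (v : Fin (k + 1) → ℝ), v ∈ Box γ k → z ≤ v (Fin.last k) → 1 / (v (Fin.last k)) ^ 2 - β k v ≤ 1 / z ^ 2)
    {k : ℕ} {v : Fin (k + 1) → ℝ} (hv : v ∈ Box γ k) (hfoot : v (Fin.last k) = z) : 0 ≤ β k v := by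
  have := h k v hv hfoot.ge
  rw [hfoot] at this
  linarith

/-- **THE SIGN CLASS LIES INSIDE THE LETTER**: `0 ≤ β` on the box of level `γ` (`FlowStep.BetaLowerH 0 γ β`, the K0-side letter) ⟹ no jump over ANY foot `z > 0` at level `γ`.
P3 n°101 `noJumpAt_of_betaLowerH_zero`. [folklore] -/
theorem noJumpAt_of_betaLowerH_zero {γ : ℝ} (h : BetaLowerH 0 γ β) {z : ℝ} (hz : 0 < z) :
    ∀ (k : ℕ) (v : Fin (k + 1) → ℝ), v ∈ Box γ k → z ≤ v (Fin.last k) → 1 / (v (Fin.last k)) ^ 2 - β k v ≤ 1 / z ^ 2 := by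
  intro k v hv hzv
  have hb := h k v hv
  have h1 : 1 / (v (Fin.last k)) ^ 2 ≤ 1 / z ^ 2 := one_div_le_one_div_of_le (by positivity) (pow_le_pow_left₀ hz.le hzv 2)
  linarith

/-- under the sign, TOP RUNS ARE FLAT: the threshold at level `γ` is `γ` itself … P3 n°101 `topRunsAt_self_of_betaLowerH_zero`. [folklore] -/
theorem topRunsAt_self_of_betaLowerH_zero {γ : ℝ} (h : BetaLowerH 0 γ β) (hγ : 0 < γ) :
    ∀ (n : ℕ) (gs : ℕ → ℝ), RGEqH n β gs → Step.InInterval γ n gs → ∀ k, k ≤ n → gs k = γ → γ ≤ gs n :=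
  topRunsAt_of_noJumpAt hγ le_rfl (noJumpAt_of_betaLowerH_zero h hγ)

/-- … i.e. an in-window run that touches the top stays there. P3 n°101 `topRun_flat_of_betaLowerH_zero`. [folklore] -/
theorem topRun_flat_of_betaLowerH_zero {γ : ℝ} (h : BetaLowerH 0 γ β) (hγ : 0 < γ) {n : ℕ} {gs : ℕ → ℝ} (hrg : RGEqH n β gs)
    (hI : Step.InInterval γ n gs) {k : ℕ} (hk : k ≤ n) (hgk : gs k = γ) : gs n = γ :=
  le_antisymm (hI n le_rfl).2 (topRunsAt_self_of_betaLowerH_zero h hγ n gs hrg hI k hk hgk)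

end Foot

/-! ## §3 The no-jump LADDER with linear feet `z ∈ [cγ, γ]` feeds the dial's (T) family AND the no-shrink letter — P3 n°101 §5 (census C365 (b) executed) -/

section Ladder

/-- **THE LADDER GIVES (T) WITH LINEAR THRESHOLDS `cγ`** at every level `γ ≤ γ′` (the ladder inline as `h`: at every level a foot `z ∈ [cγ, γ]` with no jump over it).
P3 n°101 `topRunsAt_linear_of_noJumpLadder`. [cite: Balaban1987RG1, Thm 2 p.259 (first sentence), (0.20) p.256 (elementary)] -/
theorem topRunsAt_linear_of_noJumpLadder {c γ' : ℝ} (hc : 0 < c)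
    (h : ∀ γ : ℝ, 0 < γ → γ ≤ γ' → ∃ z : ℝ, c * γ ≤ z ∧ z ≤ γ ∧
      ∀ (k : ℕ) (v : Fin (k + 1) → ℝ), v ∈ Box γ k → z ≤ v (Fin.last k) → 1 / (v (Fin.last k)) ^ 2 - β k v ≤ 1 / z ^ 2)
    {γ : ℝ} (hγ : 0 < γ) (hle : γ ≤ γ') :
    ∀ (n : ℕ) (gs : ℕ → ℝ), RGEqH n β gs → Step.InInterval γ n gs → ∀ k, k ≤ n → gs k = γ → c * γ ≤ gs n := by
  obtain ⟨z, hcz, hzγ, hnj⟩ := h γ hγ hle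
  exact fun n gs hrg hI k hk hgk => hcz.trans (topRunsAt_of_noJumpAt (lt_of_lt_of_le (by positivity) hcz) hzγ hnj n gs hrg hI k hk hgk)

/-- … hence THE DIAL's (T) FAMILY on `]0, γ′]`. P3 n°101 `topRunsFamily_of_noJumpLadder`. [cite: Balaban1987RG1, Thm 2 p.259 (first sentence) (elementary)] -/
theorem topRunsFamily_of_noJumpLadder {c γ' : ℝ} (hc : 0 < c)
    (h : ∀ γ : ℝ, 0 < γ → γ ≤ γ' → ∃ z : ℝ, c * γ ≤ z ∧ z ≤ γ ∧
      ∀ (k : ℕ) (v : Fin (k + 1) → ℝ), v ∈ Box γ k → z ≤ v (Fin.last k) → 1 / (v (Fin.last k)) ^ 2 - β k v ≤ 1 / z ^ 2) :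
    ∀ γ : ℝ, 0 < γ → γ ≤ γ' → ∃ gstar : ℝ, 0 < gstar ∧
      ∀ (n : ℕ) (gs : ℕ → ℝ), RGEqH n β gs → Step.InInterval γ n gs → ∀ k, k ≤ n → gs k = γ → gstar ≤ gs n :=
  fun γ hγ hle => ⟨c * γ, by positivity, topRunsAt_linear_of_noJumpLadder hc h hγ hle⟩

/-- … AND, for `c ≤ 1`, NO-`c`-SHRINK AT LEVEL `γ′`: `g_m ≤ c⁻¹·g_{n′}` between any two times of an in-`]0,γ′]` run (§1's converse edge with `1 + β₀ = 1∕c`).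
P3 n°101 `runwiseMulFloor_of_noJumpLadder`. [cite: Balaban1988Convergent, (2.6) p.255 (last member); Balaban1987RG1, (0.20) p.256 (elementary)] -/
theorem noShrink_of_noJumpLadder {c γ' : ℝ} (hc : 0 < c) (hc1 : c ≤ 1)
    (h : ∀ γ : ℝ, 0 < γ → γ ≤ γ' → ∃ z : ℝ, c * γ ≤ z ∧ z ≤ γ ∧
      ∀ (k : ℕ) (v : Fin (k + 1) → ℝ), v ∈ Box γ k → z ≤ v (Fin.last k) → 1 / (v (Fin.last k)) ^ 2 - β k v ≤ 1 / z ^ 2) :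
    ∀ (n : ℕ) (gs : ℕ → ℝ), RGEqH n β gs → Step.InInterval γ' n gs → ∀ m n', m < n' → n' ≤ n → gs m ≤ (1 + (1 / c - 1)) * gs n' := by
  refine noShrink_of_linearTopRuns (by rw [sub_nonneg, le_div_iff₀ hc]; linarith) fun γ hγ hle => ?_
  have h1 : γ / (1 + (1 / c - 1)) = c * γ := by
    field_simp
    ring
  rw [h1]
  exact topRunsAt_linear_of_noJumpLadder hc h hγ hle

/-- ★ **C365 (b) EXECUTED — THE NEAR-ZERO NO-JUMP LADDER FEEDS THE DIAL's (T) FAMILY AND THE NO-SHRINK LETTER, with `β₀ = 1∕c − 1`** (the located letter VERBATIM as `h`: `∃ c ∈ ]0,1], ∀ γ ∈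
]0,γ′], ∃ z ∈ [cγ, γ]`, no jump over `z` at level `γ`): ⟹ a positive top-run threshold at every level `≤ γ′` (the (T) conjunct of the END-exact dial, p633163's inline text) ∧ some `β₀ ≥ 0`
with no-(1+β₀)⁻¹-shrink at level `γ′` ([III] (2.6)'s last member along runs, file 10's letter) ∧ the linear thresholds `γ∕(1+β₀)`.  NOT row (iv): the sawtooth of FILES 5–6 carries the
ladder with `c = ½` (its teeth are feet) and violates row (iv) at every level.  So, supplier-facing: the weakest POINTWISE letter on a β located so far that pays the dial is THIS, and it is
strictly weaker than the sign datum `0 ≤ β` (`ladderNoJump_of_betaLowerH_zero`). P3 n°101 `dial_of_ladderNoJump`. [cite: Balaban1987RG1, Thm 2 p.259 (first sentence), (0.20) p.256; Balaban1988Convergent, (2.6) p.255 (elementary)] -/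
theorem dial_of_ladderNoJump {γ' : ℝ}
    (h : ∃ c : ℝ, 0 < c ∧ c ≤ 1 ∧ ∀ γ : ℝ, 0 < γ → γ ≤ γ' → ∃ z : ℝ, c * γ ≤ z ∧ z ≤ γ ∧
      ∀ (k : ℕ) (v : Fin (k + 1) → ℝ), v ∈ Box γ k → z ≤ v (Fin.last k) → 1 / (v (Fin.last k)) ^ 2 - β k v ≤ 1 / z ^ 2) :
    (∀ γ : ℝ, 0 < γ → γ ≤ γ' → ∃ gstar : ℝ, 0 < gstar ∧
        ∀ (n : ℕ) (gs : ℕ → ℝ), RGEqH n β gs → Step.InInterval γ n gs → ∀ k, k ≤ n → gs k = γ → gstar ≤ gs n) ∧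
      ∃ β₀ : ℝ, 0 ≤ β₀ ∧
        (∀ (n : ℕ) (gs : ℕ → ℝ), RGEqH n β gs → Step.InInterval γ' n gs → ∀ m n', m < n' → n' ≤ n → gs m ≤ (1 + β₀) * gs n') ∧
        (∀ γ : ℝ, 0 < γ → γ ≤ γ' →
          ∀ (n : ℕ) (gs : ℕ → ℝ), RGEqH n β gs → Step.InInterval γ n gs → ∀ k, k ≤ n → gs k = γ → γ / (1 + β₀) ≤ gs n) := by
  obtain ⟨c, hc, hc1, hL⟩ := h
  have hβ₀ : 0 ≤ 1 / c - 1 := by rw [sub_nonneg, le_div_iff₀ hc]; linarith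
  have hmul := noShrink_of_noJumpLadder hc hc1 hL
  exact ⟨topRunsFamily_of_noJumpLadder hc hL, 1 / c - 1, hβ₀, hmul, topRuns_of_noShrink hβ₀ hmul⟩

/-- under the sign `0 ≤ β` on `]0,γ′]`, the LADDER holds with feet AT the levels (`c = 1`). P3 n°101 `noJumpLadder_one_of_betaLowerH_zero`. [folklore] -/
theorem noJumpLadder_one_of_betaLowerH_zero {γ' : ℝ} (h : BetaLowerH 0 γ' β) :
    ∀ γ : ℝ, 0 < γ → γ ≤ γ' → ∃ z : ℝ, 1 * γ ≤ z ∧ z ≤ γ ∧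
      ∀ (k : ℕ) (v : Fin (k + 1) → ℝ), v ∈ Box γ k → z ≤ v (Fin.last k) → 1 / (v (Fin.last k)) ^ 2 - β k v ≤ 1 / z ^ 2 :=
  fun γ hγ hle => ⟨γ, by rw [one_mul], le_rfl,
    noJumpAt_of_betaLowerH_zero (fun k v hv => h k v (mem_box.mpr fun i => ⟨(mem_box.mp hv i).1, (mem_box.mp hv i).2.trans hle⟩)) hγ⟩

/-- **THE SIGN CLASS IS INSIDE THE LADDER LETTER** (`c = 1`): `0 ≤ β` on `]0,γ′]` ⟹ the near-zero no-jump ladder on `]0,γ′]`. P3 n°101 `ladderNoJump_of_betaLowerH_zero`. [folklore] -/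
theorem ladderNoJump_of_betaLowerH_zero {γ' : ℝ} (h : BetaLowerH 0 γ' β) :
    ∃ c : ℝ, 0 < c ∧ c ≤ 1 ∧ ∀ γ : ℝ, 0 < γ → γ ≤ γ' → ∃ z : ℝ, c * γ ≤ z ∧ z ≤ γ ∧
      ∀ (k : ℕ) (v : Fin (k + 1) → ℝ), v ∈ Box γ k → z ≤ v (Fin.last k) → 1 / (v (Fin.last k)) ^ 2 - β k v ≤ 1 / z ^ 2 :=
  ⟨1, one_pos, le_rfl, noJumpLadder_one_of_betaLowerH_zero h⟩

end Ladder

end Summit.QuantumFields.YangMills.Theorems.BalabanUVNodesK1EndExactNoJumpLadder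

end
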